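import Mathlib.Geometry.Manifold.PartitionOfUnity
import Literature.Topology.FourManifolds.WhiteheadExtendP
import Literature.Topology.FourManifolds.PLStructuresProofs
import HarnessLib

/-!
# Whitehead triangulations: canonical coordinates of the extension step, and one stage of the inductive construction (Munkres 10.4–10.6)

Three parts (merged into one module to shorten the landing chain; each part was developed and
checked separately):

* **Canonical coordinates (end of the extension step, Munkres 10.4).** The glued complex
  `G₃ ⊆ V₃` of `WhiteheadExtendG/F/P` is transported to a canonical coordinate complex `K₃c` in
  `ℝ^{N₃}` (`CanonicalComplex.canonical`) and the extended map becomes `f₃c = F₃ ∘ real`: a finite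
  pure coordinate complex, `f₃c` injective and simplexwise continuous, image
  `f' '' K''.space ∪ e.symm '' R₀`, every simplex old (`f₃c = f' ∘ B`) or new (`e ∘ f₃c = A`
  affine, inside the inner box or the image of a straight simplex), straightness near the outer box.
* **The stage (Munkres 10.5).** States (`TriState`), chart invariants (`ChartInv`), cover pieces
  (`Piece`), the bending input of a stage (`bendInput`: levels = boxes of the piece, smooth cut-off,
  protected set = cores of the charts built so far, tolerance below the chart margins), smooth
  chart models of the new state (`next_model`, via `hasModel_transport`), and the new state `next`
  (old charts transported by the comparison map `Ψ` and deprived of the inner box unless untouched;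
  the new chart is `e` on `e.symm '' (open outer box) ∩ interior (image)`).
* **The invariants.** `ChartInv` holds for every chart of the new state (`chartInv_next`), the cores
  of the new state cover the old cores and the new piece (`cores_next`), untouched charts keep
  their data, unborn charts stay empty.

No named facts are introduced (`HasModel`, `ChartInv`, `Untouched` are `Prop`-valued structures,
`TriState`, `Piece` bookkeeping structures).
-/

open Set Function Metric Filter
open scoped Topology NNReal Manifold ContDiff

noncomputable section

-- `[T2Space M]` is a section variable used by most lemmas below; per-lemma `omit` would be noise.
set_option linter.unusedSectionVars false

namespace Literature.Topology.FourManifolds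

open Literature.Analysis.Convexity Literature.Analysis.Convexity.SignArrangement

local notation "𝔼 " n:arg => EuclideanSpace ℝ (Fin n)

/-! ## Part A: canonical coordinates of the extension step -/

namespace BendInput

variable {n N : ℕ} {M : Type*} [TopologicalSpace M] [T2Space M] {I : BendInput n N M}

namespace BendSetup

variable {S : BendSetup I} (X : ExtInput S)

namespace ExtInput

/-! ### The vertex enumeration and the canonical complex -/

/-- A vertex enumeration of `G₃` exists. [folklore] -/
theorem exists_enum : ∃ (N₃ : ℕ) (vtx : Fin N₃ → V₃ n N), Injective vtx ∧
    (∀ T ∈ X.G₃.faces, ∀ v ∈ T, ∃ i, vtx i = v) ∧ ∀ i, ∃ T ∈ X.G₃.faces, vtx i ∈ T :=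
  exists_vertex_enumeration X.G₃_finite

/-- The number of vertices. [folklore] -/
def N₃ : ℕ := X.exists_enum.choose

/-- The vertex enumeration. [folklore] -/
def vtx : Fin X.N₃ → V₃ n N := X.exists_enum.choose_spec.choose

/-- Auxiliary (`vtx_injective`). [folklore] -/
theorem vtx_injective : Injective X.vtx := X.exists_enum.choose_spec.choose_spec.1

/-- Auxiliary (`vtx_range`). [folklore] -/
theorem vtx_range : ∀ T ∈ X.G₃.faces, ∀ v ∈ T, ∃ i, X.vtx i = v := X.exists_enum.choose_spec.choose_spec.2.1

/-- **The canonical coordinate complex of the stage.** [folklore] -/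
def K₃c : Geometry.SimplicialComplex ℝ (Fin X.N₃ → ℝ) := canonical X.G₃ X.vtx X.vtx_injective X.vtx_range

/-- Auxiliary (`mem_K₃c_faces`). [folklore] -/
theorem mem_K₃c_faces {τ : Finset (Fin X.N₃ → ℝ)} :
    τ ∈ X.K₃c.faces ↔ ∃ T ∈ X.G₃.faces, coordSimplex (idx X.vtx T) = τ := Iff.rfl

/-- `K₃c` is a coordinate complex. [folklore] -/
theorem isCoordinate_K₃c : IsCoordinate X.K₃c := isCoordinate_canonical

/-- `K₃c` is finite. [folklore] -/
theorem K₃c_finite : X.K₃c.faces.Finite := canonical_faces_finite X.G₃_finite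

/-- The index set of a face has the cardinality of the face. [folklore] -/
theorem card_idx {T : Finset (V₃ n N)} (hT : T ∈ X.G₃.faces) : (idx X.vtx T).card = T.card := by
  classical
  conv_rhs => rw [← image_vtx_idx (X.vtx_range T hT)]
  rw [Finset.card_image_of_injective _ X.vtx_injective]

/-- Auxiliary (`card_coordSimplex`). [folklore] -/
theorem card_coordSimplex' (J : Finset (Fin X.N₃)) : (coordSimplex J).card = J.card := by
  classical
  unfold coordSimplex
  exact Finset.card_image_of_injective _ single_one_injective

/-- **`K₃c` is pure.** [folklore] -/
theorem K₃c_pure {τ : Finset (Fin X.N₃ → ℝ)} (hτ : τ ∈ X.K₃c.faces) :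
    ∃ τ' ∈ X.K₃c.faces, τ ⊆ τ' ∧ τ'.card = n + 1 := by
  obtain ⟨T, hT, rfl⟩ := X.mem_K₃c_faces.1 hτ
  obtain ⟨T', hT', hTT', hcard⟩ := X.G₃_pure hT
  refine ⟨coordSimplex (idx X.vtx T'), X.mem_K₃c_faces.2 ⟨T', hT', rfl⟩,
    coordSimplex_subset_iff.2 (idx_mono hTT'), ?_⟩
  rw [card_coordSimplex', X.card_idx hT', hcard]

/-! ### The transported map -/

/-- **The map of the stage in canonical coordinates**: `f₃c = F₃ ∘ real`. [folklore] -/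
def f₃c : (Fin X.N₃ → ℝ) → M := X.F₃ ∘ real X.vtx

/-- The realisation maps `K₃c.space` into `G₃.space`. [folklore] -/
theorem real_mem {y : Fin X.N₃ → ℝ} (hy : y ∈ X.K₃c.space) : real X.vtx y ∈ X.G₃.space := by
  classical
  rw [← image_real_canonical_space (K := X.G₃) (hinj := X.vtx_injective) (hrange := X.vtx_range)]
  exact ⟨y, hy, rfl⟩

/-- The realisation maps a closed coordinate simplex onto the closed face. [folklore] -/
theorem image_real_face {T : Finset (V₃ n N)} (hT : T ∈ X.G₃.faces) :
    real X.vtx '' convexHull ℝ ((coordSimplex (idx X.vtx T) : Finset (Fin X.N₃ → ℝ)) : Set (Fin X.N₃ → ℝ)) =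
      convexHull ℝ (T : Set (V₃ n N)) := by
  classical
  exact image_real_convexHull (X.vtx_range T hT)

/-- **`f₃c` is injective on `K₃c.space`.** [folklore] -/
theorem injOn_f₃c : InjOn X.f₃c X.K₃c.space := by
  classical
  intro y hy y' hy' h
  have hinj := injOn_real_canonical_space (K := X.G₃) (hinj := X.vtx_injective) (hrange := X.vtx_range)
  exact hinj hy hy' (X.injOn_F₃ (X.real_mem hy) (X.real_mem hy') h)

/-- **`f₃c` is continuous on every closed simplex.** [folklore] -/
theorem continuousOn_f₃c {τ : Finset (Fin X.N₃ → ℝ)} (hτ : τ ∈ X.K₃c.faces) :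
    ContinuousOn X.f₃c (convexHull ℝ (τ : Set (Fin X.N₃ → ℝ))) := by
  obtain ⟨T, hT, rfl⟩ := X.mem_K₃c_faces.1 hτ
  refine (X.continuousOn_F₃ hT).comp (real X.vtx).continuous_of_finiteDimensional.continuousOn fun y hy => ?_
  rw [← X.image_real_face hT]; exact ⟨y, hy, rfl⟩

/-- **The image of the stage.** [folklore] -/
theorem f₃c_image : X.f₃c '' X.K₃c.space = S.fbend '' S.Kb.space ∪ I.e.symm '' X.R₀ := by
  classical
  have h : real X.vtx '' X.K₃c.space = X.G₃.space :=
    image_real_canonical_space (K := X.G₃) (hinj := X.vtx_injective) (hrange := X.vtx_range)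
  rw [f₃c, Set.image_comp, h]
  exact X.F₃_image

/-! ### Old and new simplices of the stage -/

/-- **Old simplices of the stage**: `f₃c = f' ∘ B` for an affine map `B` onto an unchanged
simplex of `K''`. [folklore] -/
theorem old_simplex {σ : Finset (Fin N → ℝ)} (hσ : σ ∈ X.U) :
    ∃ B : (Fin X.N₃ → ℝ) →ᵃ[ℝ] (Fin N → ℝ),
      B '' convexHull ℝ ((coordSimplex (idx X.vtx (S.oldFace σ)) : Finset (Fin X.N₃ → ℝ)) : Set (Fin X.N₃ → ℝ)) =
        convexHull ℝ (σ : Set (Fin N → ℝ)) ∧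
      ∀ y ∈ convexHull ℝ ((coordSimplex (idx X.vtx (S.oldFace σ)) : Finset (Fin X.N₃ → ℝ)) : Set (Fin X.N₃ → ℝ)),
        X.f₃c y = S.fbend (B y) := by
  have hT := X.oldFace_mem_G₃ hσ
  obtain ⟨heq, himg⟩ := X.old_face_desc hσ
  refine ⟨(LinearMap.fst ℝ (Fin N → ℝ) (EuclideanSpace ℝ (Fin n) × ℝ)).toAffineMap.comp (real X.vtx).toAffineMap, ?_, fun y hy => ?_⟩
  · rw [AffineMap.coe_comp, Set.image_comp]
    show Prod.fst '' (real X.vtx '' _) = _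
    rw [X.image_real_face hT, himg]
  · have hx : real X.vtx y ∈ convexHull ℝ ((S.oldFace σ : Finset (V₃ n N)) : Set (V₃ n N)) := by
      rw [← X.image_real_face hT]; exact ⟨y, hy, rfl⟩
    exact heq hx

/-- **New simplices of the stage**: `e ∘ f₃c = A` for an affine map `A` onto the closed chart
simplex, which lies in the inner box or in the image of a straight simplex. [folklore] -/
theorem new_simplex {ρ : Finset (𝔼 n)} (hρ : ρ ∈ X.H.faces) :
    ∃ A : (Fin X.N₃ → ℝ) →ᵃ[ℝ] 𝔼 n,
      (∀ y ∈ convexHull ℝ ((coordSimplex (idx X.vtx (S.newFace ρ)) : Finset (Fin X.N₃ → ℝ)) : Set (Fin X.N₃ → ℝ)),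
        X.f₃c y ∈ I.e.source ∧ I.e (X.f₃c y) = A y) ∧
      A '' convexHull ℝ ((coordSimplex (idx X.vtx (S.newFace ρ)) : Finset (Fin X.N₃ → ℝ)) : Set (Fin X.N₃ → ℝ)) =
        convexHull ℝ (ρ : Set (𝔼 n)) ∧
      (convexHull ℝ (ρ : Set (𝔼 n)) ⊆ X.R₀ ∨
        ∃ u₀ ∈ S.Str, convexHull ℝ (ρ : Set (𝔼 n)) ⊆ S.Λ '' convexHull ℝ (u₀ : Set (Fin N → ℝ))) := by
  have hT := X.newFace_mem_G₃ hρ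
  obtain ⟨A, -, hA, himg⟩ := X.new_face_desc hρ
  refine ⟨A.comp (real X.vtx).toAffineMap, fun y hy => ?_, ?_, X.new_face_inside hρ⟩
  · have hx : real X.vtx y ∈ convexHull ℝ ((S.newFace ρ : Finset (V₃ n N)) : Set (V₃ n N)) := by
      rw [← X.image_real_face hT]; exact ⟨y, hy, rfl⟩
    exact hA _ hx
  · rw [AffineMap.coe_comp, Set.image_comp]
    show A '' (real X.vtx '' _) = _
    rw [X.image_real_face hT, himg]

/-- **Dichotomy of the simplices of the stage.** [folklore] -/
theorem simplex_cases {τ : Finset (Fin X.N₃ → ℝ)} (hτ : τ ∈ X.K₃c.faces) :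
    (∃ σ ∈ X.U, coordSimplex (idx X.vtx (S.oldFace σ)) = τ) ∨
      ∃ ρ ∈ X.H.faces, coordSimplex (idx X.vtx (S.newFace ρ)) = τ := by
  obtain ⟨T, hT | hT, rfl⟩ := X.mem_K₃c_faces.1 hτ
  · obtain ⟨σ, hσ, rfl⟩ := hT; exact Or.inl ⟨σ, hσ, rfl⟩
  · obtain ⟨ρ, hρ, rfl⟩ := hT; exact Or.inr ⟨ρ, hρ, rfl⟩

/-- **Straightness of the stage for the new chart**: a simplex whose image meets
`e.symm '' (open outer box)` is mapped affinely by `e ∘ f₃c`, inside the chart source. [folklore] -/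
theorem straight_stage {τ : Finset (Fin X.N₃ → ℝ)} (hτ : τ ∈ X.K₃c.faces)
    (hmeet : (X.f₃c '' convexHull ℝ (τ : Set (Fin X.N₃ → ℝ)) ∩ I.e.symm '' openBox X.aP X.bP).Nonempty) :
    ∃ A : (Fin X.N₃ → ℝ) →ᵃ[ℝ] 𝔼 n, ∀ y ∈ convexHull ℝ (τ : Set (Fin X.N₃ → ℝ)),
      X.f₃c y ∈ I.e.source ∧ I.e (X.f₃c y) = A y := by
  obtain ⟨T, hT, rfl⟩ := X.mem_K₃c_faces.1 hτ
  have hmeet' : (X.F₃ '' convexHull ℝ (T : Set (V₃ n N)) ∩ I.e.symm '' openBox X.aP X.bP).Nonempty := by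
    obtain ⟨q, ⟨y, hy, rfl⟩, hq⟩ := hmeet
    refine ⟨X.f₃c y, ⟨real X.vtx y, ?_, rfl⟩, hq⟩
    rw [← X.image_real_face hT]; exact ⟨y, hy, rfl⟩
  obtain ⟨A, hA⟩ := X.straight_of_meets hT hmeet'
  refine ⟨A.comp (real X.vtx).toAffineMap, fun y hy => ?_⟩
  have hx : real X.vtx y ∈ convexHull ℝ (T : Set (V₃ n N)) := by
    rw [← X.image_real_face hT]; exact ⟨y, hy, rfl⟩
  exact hA _ hx

end ExtInput

end BendSetup

end BendInput


/-! ## Part B: the stage -/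

/-! ### States and chart invariants -/

section State

variable (n : ℕ) (M : Type*) [TopologicalSpace M] [ChartedSpace (EuclideanSpace ℝ (Fin n)) M]

/-- **Smooth chart models** of `e' ∘ f` on a simplex: a `C^∞` map on an open set containing the
part of the closed simplex mapped into the chart source, agreeing with `e' ∘ f` there, with
derivative injective on the direction space. (A `Prop`-valued structure: bookkeeping, not a named
fact.) [folklore] -/
structure HasModel {N : ℕ} (f : (Fin N → ℝ) → M) (s : Finset (Fin N → ℝ))
    (e' : OpenPartialHomeomorph M (𝔼 n)) : Prop where
  /-- the model -/
  out : ∃ O : Set (Fin N → ℝ), ∃ G : (Fin N → ℝ) → 𝔼 n,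
    IsOpen O ∧ convexHull ℝ (s : Set (Fin N → ℝ)) ∩ f ⁻¹' e'.source ⊆ O ∧ ContDiffOn ℝ ∞ G O ∧
    EqOn (e' ∘ f) G (convexHull ℝ (s : Set (Fin N → ℝ)) ∩ f ⁻¹' e'.source) ∧
    ∀ x ∈ convexHull ℝ (s : Set (Fin N → ℝ)) ∩ f ⁻¹' e'.source,
      ∀ u ∈ vectorSpan ℝ (s : Set (Fin N → ℝ)), fderiv ℝ G x u = 0 → u = 0

/-- **The state of the induction** (Munkres 10.6): a pure finite coordinate complex `K ⊆ ℝᴺ`, a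
map `f` into the manifold, injective and simplexwise continuous on `K.space`, with smooth chart
models on the top simplices for every chart of the atlas, and the data `(W j, φ j, C' j)` of the PL
charts built so far (open set, chart map, compact core). (Bookkeeping structure.) [folklore] -/
structure TriState where
  /-- dimension of the coordinate space -/
  N : ℕ
  /-- the complex -/
  K : Geometry.SimplicialComplex ℝ (Fin N → ℝ)
  hK : IsCoordinate K
  pure : ∀ r ∈ K.faces, ∃ s ∈ K.faces, r ⊆ s ∧ s.card = n + 1
  /-- the map -/
  f : (Fin N → ℝ) → M
  inj : InjOn f K.space
  cont : ∀ s ∈ K.faces, ContinuousOn f (convexHull ℝ (s : Set (Fin N → ℝ)))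
  model : ∀ s ∈ K.faces, s.card = n + 1 → ∀ e' ∈ atlas (𝔼 n) M, HasModel n M f s e'
  /-- the charts built so far: birth region, open set, chart map, compact core -/
  D : ℕ → Set M
  W : ℕ → Set M
  φ : ℕ → M → 𝔼 n
  C' : ℕ → Set M

variable {n M}

/-- **The invariants of a PL chart** `(W j, φ j, C' j)` of a state: `W j` is open inside
`f '' K.space` and inside the birth region `D j`, `φ j` is injective, continuous and open on it and
affine along `f` on every simplex (where defined), and the core `C' j ⊆ W j` is compact.
(Prop-valued structure.) [folklore] -/
structure ChartInv (st : TriState n M) (j : ℕ) : Prop where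
  isOpen : IsOpen (st.W j)
  isOpenD : IsOpen (st.D j)
  subsetD : st.W j ⊆ st.D j
  subset : st.W j ⊆ st.f '' st.K.space
  inj : InjOn (st.φ j) (st.W j)
  cont : ContinuousOn (st.φ j) (st.W j)
  openMap : ∀ U ⊆ st.W j, IsOpen U → IsOpen (st.φ j '' U)
  affine : ∀ s ∈ st.K.faces, ∃ A : (Fin st.N → ℝ) →ᵃ[ℝ] 𝔼 n,
    EqOn (st.φ j ∘ st.f) A (convexHull ℝ (s : Set (Fin st.N → ℝ)) ∩ st.f ⁻¹' st.W j)
  compact : IsCompact (st.C' j)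
  core : st.C' j ⊆ st.W j

/-- The core of a chart lies in the interior of `f '' K.space`. [folklore] -/
theorem ChartInv.core_subset_interior {st : TriState n M} {j : ℕ} (h : ChartInv st j) :
    st.C' j ⊆ interior (st.f '' st.K.space) :=
  h.core.trans (interior_maximal h.subset h.isOpen)

end State

/-! ### Cover pieces -/

section Piece

variable (n : ℕ) (M : Type*) [TopologicalSpace M] [ChartedSpace (EuclideanSpace ℝ (Fin n)) M]

/-- **A cover piece**: a chart of the atlas and eight strictly nested non-degenerate coordinate
boxes `B₀ ⋐ B₁ ⋐ ⋯ ⋐ B₇` in its target with a common margin `η` (`B₀` carries the piece of the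
cover, `B₁` is the inner box `R₀`, `B₂` the core box, `B₃` the outer box `R₀⁺`, and `B₄,…,B₇` the
levels `R₁,…,R₄` of the bending step). (Bookkeeping structure.) [folklore] -/
structure Piece where
  /-- the chart -/
  e : OpenPartialHomeomorph M (𝔼 n)
  he : e ∈ atlas (𝔼 n) M
  /-- box corners -/
  a : Fin 8 → Fin n → ℝ
  b : Fin 8 → Fin n → ℝ
  hab : ∀ ℓ i, a ℓ i < b ℓ i
  /-- the margin -/
  η : ℝ
  hη : 0 < η
  hnest : ∀ ℓ : Fin 7, cthickening η (box (a ℓ.castSucc) (b ℓ.castSucc)) ⊆ box (a ℓ.succ) (b ℓ.succ)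
  htarget : box (a 7) (b 7) ⊆ e.target

variable {n M} (P : Piece n M)

namespace Piece

/-- The `ℓ`-th box of the piece. [folklore] -/
def B (ℓ : Fin 8) : Set (𝔼 n) := box (P.a ℓ) (P.b ℓ)

/-- Auxiliary (`isCompact_B`). [folklore] -/
theorem isCompact_B (ℓ : Fin 8) : IsCompact (P.B ℓ) := isCompact_box _ _

/-- Consecutive boxes with margin. [folklore] -/
theorem cthickening_B_subset (ℓ : Fin 7) : cthickening P.η (P.B ℓ.castSucc) ⊆ P.B ℓ.succ := P.hnest ℓ

/-- Auxiliary (`B_subset_succ`). [folklore] -/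
theorem B_subset_succ (ℓ : Fin 7) : P.B ℓ.castSucc ⊆ P.B ℓ.succ :=
  (self_subset_cthickening _).trans (P.cthickening_B_subset ℓ)

/-- The boxes are monotone. [folklore] -/
theorem B_mono {ℓ ℓ' : Fin 8} (h : ℓ ≤ ℓ') : P.B ℓ ⊆ P.B ℓ' := by
  induction ℓ' using Fin.induction with
  | zero => rw [Fin.le_zero_iff.1 h]
  | succ ℓ' ih =>
    rcases h.lt_or_eq with hlt | heq
    · exact (ih (Fin.le_castSucc_iff.2 hlt)).trans (P.B_subset_succ ℓ')
    · rw [heq]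

/-- Every box lies in the chart target. [folklore] -/
theorem B_subset_target (ℓ : Fin 8) : P.B ℓ ⊆ P.e.target := (P.B_mono (Fin.le_last ℓ)).trans P.htarget

/-- A box lies in the open box of the next level. [folklore] -/
theorem B_subset_openBox (ℓ : Fin 7) : P.B ℓ.castSucc ⊆ openBox (P.a ℓ.succ) (P.b ℓ.succ) := by
  intro x hx i
  have hball : closedBall x P.η ⊆ P.B ℓ.succ :=
    (closedBall_subset_cthickening hx P.η).trans (P.cthickening_B_subset ℓ)
  -- the points `x ± η eᵢ` lie in the next box
  have hplus : x + PiLp.single 2 i P.η ∈ P.B ℓ.succ := hball (by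
    rw [mem_closedBall, dist_eq_norm, add_sub_cancel_left, PiLp.norm_single, Real.norm_eq_abs, abs_of_pos P.hη])
  have hminus : x - PiLp.single 2 i P.η ∈ P.B ℓ.succ := hball (by
    rw [mem_closedBall, dist_eq_norm, sub_sub_cancel_left, norm_neg, PiLp.norm_single, Real.norm_eq_abs, abs_of_pos P.hη])
  have h1 := (hplus i).2
  have h2 := (hminus i).1
  simp only [PiLp.add_apply, PiLp.sub_apply, PiLp.single_apply, if_true] at h1 h2
  constructor <;> linarith [P.hη]

/-- A box lies in the interior of the next box. [folklore] -/
theorem B_subset_interior (ℓ : Fin 7) : P.B ℓ.castSucc ⊆ interior (P.B ℓ.succ) :=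
  (P.B_subset_openBox ℓ).trans (openBox_subset_interior_box _ _)

/-- Strict nesting of the corners. [folklore] -/
theorem corner_lt (ℓ : Fin 7) (i : Fin n) : P.a ℓ.succ i < P.a ℓ.castSucc i ∧ P.b ℓ.castSucc i < P.b ℓ.succ i := by
  -- the corner point `a` of the smaller box lies in the open bigger box
  have hne : (P.B ℓ.castSucc).Nonempty := by
    refine ⟨(WithLp.equiv 2 (Fin n → ℝ)).symm (P.a ℓ.castSucc), fun j => ⟨le_rfl, (P.hab _ j).le⟩⟩
  have ha : (WithLp.equiv 2 (Fin n → ℝ)).symm (P.a ℓ.castSucc) ∈ P.B ℓ.castSucc := fun j => ⟨le_rfl, (P.hab _ j).le⟩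
  have hb : (WithLp.equiv 2 (Fin n → ℝ)).symm (P.b ℓ.castSucc) ∈ P.B ℓ.castSucc := fun j => ⟨(P.hab _ j).le, le_rfl⟩
  have h1 := (P.B_subset_openBox ℓ ha i).1
  have h2 := (P.B_subset_openBox ℓ hb i).2
  exact ⟨h1, h2⟩

/-- The cover piece: `e.symm '' B₀`. [folklore] -/
def Cpiece : Set M := P.e.symm '' P.B 0

/-- Auxiliary (`isCompact_Cpiece`). [folklore] -/
theorem isCompact_Cpiece : IsCompact P.Cpiece :=
  (P.isCompact_B 0).image_of_continuousOn (P.e.continuousOn_symm.mono (P.B_subset_target 0))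

end Piece

end Piece

/-! ### The bending input of a stage -/

section Input

variable {n : ℕ} {M : Type*} [TopologicalSpace M] [T2Space M] [ChartedSpace (EuclideanSpace ℝ (Fin n)) M]
  (st : TriState n M) (P : Piece n M) (k : ℕ)

/-- **The smooth cut-off of a stage**: `C^∞`, valued in `[0, 1]`, `= 1` on `B₅` and `= 0` off `B₆`.
[folklore] -/
theorem exists_theta : ∃ θ : (𝔼 n) → ℝ, ContDiff ℝ ∞ θ ∧ (∀ y, θ y ∈ Icc (0 : ℝ) 1) ∧
    (∀ y ∈ P.B 5, θ y = 1) ∧ ∀ y ∉ P.B 6, θ y = 0 := by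
  have h56 : P.B 5 ⊆ interior (P.B 6) := P.B_subset_interior 5
  obtain ⟨f, h1, h0, h01⟩ := exists_contMDiffMap_one_nhds_of_subset_interior (𝓘(ℝ, 𝔼 n)) (n := ⊤)
    (P.isCompact_B 5).isClosed h56
  refine ⟨f, ?_, h01, fun y hy => ?_, h0⟩
  · exact contMDiff_iff_contDiff.1 f.contMDiff
  · exact h1.self_of_nhdsSet y hy

/-- The cut-off. [folklore] -/
def theta : (𝔼 n) → ℝ := (exists_theta P).choose

/-- Auxiliary (`theta_spec`). [folklore] -/
theorem theta_spec : ContDiff ℝ ∞ (theta P) ∧ (∀ y, theta P y ∈ Icc (0 : ℝ) 1) ∧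
    (∀ y ∈ P.B 5, theta P y = 1) ∧ ∀ y ∉ P.B 6, theta P y = 0 := (exists_theta P).choose_spec

/-- **Chart margins**: a compact core has a uniform chart-ball margin inside its open set.
[folklore] -/
theorem exists_margin {j : ℕ} (h : ChartInv st j) : ∃ r > 0, ∀ p ∈ st.C' j, p ∈ P.e.source →
    P.e p ∈ P.B 7 → P.e.symm '' closedBall (P.e p) r ⊆ st.W j := by
  set U : Set (𝔼 n) := P.e '' (st.W j ∩ P.e.source) with hU
  have hUo : IsOpen U := P.e.isOpen_image_of_subset_source (h.isOpen.inter P.e.open_source) inter_subset_right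
  set PP : Set (𝔼 n) := P.e '' (st.C' j ∩ P.e.symm '' P.B 7) with hPP
  have hPPc : IsCompact PP := by
    refine (h.compact.inter_right ?_).image_of_continuousOn (P.e.continuousOn.mono ?_)
    · exact ((P.isCompact_B 7).image_of_continuousOn (P.e.continuousOn_symm.mono (P.B_subset_target 7))).isClosed
    · rintro p ⟨-, y, hy, rfl⟩
      exact P.e.map_target (P.B_subset_target 7 hy)
  have hPPU : PP ⊆ U := by
    rintro _ ⟨p, ⟨hp, y, hy, rfl⟩, rfl⟩
    exact ⟨P.e.symm y, ⟨h.core hp, P.e.map_target (P.B_subset_target 7 hy)⟩, rfl⟩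
  obtain ⟨r, hr, hrU⟩ := hPPc.exists_cthickening_subset_open hUo hPPU
  refine ⟨r / 2, half_pos hr, fun p hp hsrc hp7 => ?_⟩
  have hep : P.e p ∈ PP := ⟨p, ⟨hp, P.e p, hp7, P.e.left_inv hsrc⟩, rfl⟩
  have hball : closedBall (P.e p) (r / 2) ⊆ U :=
    ((closedBall_subset_cthickening hep (r / 2)).trans (cthickening_mono (by linarith) _)).trans hrU
  rintro _ ⟨z, hz, rfl⟩
  obtain ⟨q, ⟨hqW, hqs⟩, hqz⟩ := hball hz
  rw [← hqz, P.e.left_inv hqs]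
  exact hqW

/-- **The tolerance of a stage**: positive, at most `η / 4`, and so small that chart balls of that
radius about points of the cores (in the last box) stay inside the corresponding open sets.
[folklore] -/
theorem exists_eps (hinv : ∀ j < k, ChartInv st j) : ∃ ε > 0, ε ≤ P.η / 4 ∧ ∀ j < k, ∀ p ∈ st.C' j,
    p ∈ P.e.source → P.e p ∈ P.B 7 → P.e.symm '' closedBall (P.e p) ε ⊆ st.W j := by
  have hfin : (↑(Finset.range k) : Set ℕ).Finite := Finset.finite_toSet _
  obtain ⟨r, hr, hrP⟩ := exists_pos_forall_of_finite hfin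
    (P := fun j r => ∀ p ∈ st.C' j, p ∈ P.e.source → P.e p ∈ P.B 7 → P.e.symm '' closedBall (P.e p) r ⊆ st.W j)
    (fun j _ r r' _ hle hP p hp hs h7 => (image_mono (closedBall_subset_closedBall hle)).trans (hP p hp hs h7))
    (fun j hj => exists_margin st P (hinv j (Finset.mem_range.1 hj)))
  refine ⟨min (P.η / 4) r, lt_min (by linarith [P.hη]) hr, min_le_left _ _, fun j hj p hp hs h7 => ?_⟩
  exact (image_mono (closedBall_subset_closedBall (min_le_right _ _))).trans (hrP j (Finset.mem_range.2 hj) p hp hs h7)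

/-- The tolerance. [folklore] -/
def eps (hinv : ∀ j < k, ChartInv st j) : ℝ := (exists_eps st P k hinv).choose

/-- Auxiliary (`eps_spec`). [folklore] -/
theorem eps_spec (hinv : ∀ j < k, ChartInv st j) : 0 < eps st P k hinv ∧ eps st P k hinv ≤ P.η / 4 ∧
    ∀ j < k, ∀ p ∈ st.C' j, p ∈ P.e.source → P.e p ∈ P.B 7 → P.e.symm '' closedBall (P.e p) (eps st P k hinv) ⊆ st.W j := by
  obtain ⟨h0, h1, h2⟩ := (exists_eps st P k hinv).choose_spec
  exact ⟨h0, h1, h2⟩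

/-- The protected set of a stage: the cores of the charts built so far. [folklore] -/
def prot : Set M := ⋃ j ∈ Finset.range k, st.C' j

/-- Auxiliary (`isCompact_prot`). [folklore] -/
theorem isCompact_prot (hinv : ∀ j < k, ChartInv st j) : IsCompact (prot st k) :=
  (Finset.range k).isCompact_biUnion fun j hj => (hinv j (Finset.mem_range.1 hj)).compact

/-- Auxiliary (`prot_subset_interior`). [folklore] -/
theorem prot_subset_interior (hinv : ∀ j < k, ChartInv st j) : prot st k ⊆ interior (st.f '' st.K.space) := by
  intro p hp
  obtain ⟨j, hj, hpj⟩ := mem_iUnion₂.1 hp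
  exact (hinv j (Finset.mem_range.1 hj)).core_subset_interior hpj

/-- Auxiliary (`mem_prot`). [folklore] -/
theorem mem_prot {p : M} : p ∈ prot st k ↔ ∃ j < k, p ∈ st.C' j := by
  simp [prot]

/-- **The bending input of a stage.** [folklore] -/
def bendInput (hinv : ∀ j < k, ChartInv st j) : BendInput n st.N M where
  K := st.K
  hK := st.hK
  pure := st.pure
  f := st.f
  inj := st.inj
  cont := st.cont
  e := P.e
  model := fun s hs hcard => (st.model s hs hcard P.e P.he).out
  R₁ := P.B 4
  R₂ := P.B 5
  R₃ := P.B 6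
  R₄ := P.B 7
  hR₁ := P.isCompact_B 4
  hR₂ := P.isCompact_B 5
  hR₃ := P.isCompact_B 6
  hR₄ := P.isCompact_B 7
  η := P.η
  hη := P.hη
  h12 := P.cthickening_B_subset 4
  h23 := P.B_subset_succ 5
  h34 := P.cthickening_B_subset 6
  hR₄t := P.B_subset_target 7
  θ := theta P
  hθ := (theta_spec P).1
  hθ01 := (theta_spec P).2.1
  hθ1 := (theta_spec P).2.2.1
  hθ0 := (theta_spec P).2.2.2
  Prot := prot st k
  hProt := isCompact_prot st k hinv
  hProtint := prot_subset_interior st k hinv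
  εreq := eps st P k hinv
  hεreq := (eps_spec st P k hinv).1

/-- Auxiliary (`bendInput_e`). [folklore] -/
@[simp] theorem bendInput_e (hinv : ∀ j < k, ChartInv st j) : (bendInput st P k hinv).e = P.e := rfl

/-- Auxiliary (`bendInput_f`). [folklore] -/
@[simp] theorem bendInput_f (hinv : ∀ j < k, ChartInv st j) : (bendInput st P k hinv).f = st.f := rfl

/-- Auxiliary (`bendInput_K`). [folklore] -/
@[simp] theorem bendInput_K (hinv : ∀ j < k, ChartInv st j) : (bendInput st P k hinv).K = st.K := rfl

/-- Auxiliary (`bendInput_R₄`). [folklore] -/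
@[simp] theorem bendInput_R₄ (hinv : ∀ j < k, ChartInv st j) : (bendInput st P k hinv).R₄ = P.B 7 := rfl

/-- Auxiliary (`bendInput_R₃`). [folklore] -/
@[simp] theorem bendInput_R₃ (hinv : ∀ j < k, ChartInv st j) : (bendInput st P k hinv).R₃ = P.B 6 := rfl

/-- Auxiliary (`bendInput_R₂`). [folklore] -/
@[simp] theorem bendInput_R₂ (hinv : ∀ j < k, ChartInv st j) : (bendInput st P k hinv).R₂ = P.B 5 := rfl

/-- Auxiliary (`bendInput_Prot`). [folklore] -/
@[simp] theorem bendInput_Prot (hinv : ∀ j < k, ChartInv st j) : (bendInput st P k hinv).Prot = prot st k := rfl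

/-- Auxiliary (`bendInput_εreq`). [folklore] -/
@[simp] theorem bendInput_εreq (hinv : ∀ j < k, ChartInv st j) : (bendInput st P k hinv).εreq = eps st P k hinv := rfl

/-- Auxiliary (`bendInput_η`). [folklore] -/
@[simp] theorem bendInput_η (hinv : ∀ j < k, ChartInv st j) : (bendInput st P k hinv).η = P.η := rfl

/-- The set-up of a stage (a choice). [folklore] -/
def setup (hinv : ∀ j < k, ChartInv st j) : (bendInput st P k hinv).BendSetup :=
  (bendInput st P k hinv).exists_setup.some

/-- **The extension input of a stage**: inner box `B₁`, outer box `B₃`. [folklore] -/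
def extInput (hinv : ∀ j < k, ChartInv st j) : (setup st P k hinv).ExtInput where
  a₀ := P.a 1
  b₀ := P.b 1
  aP := P.a 3
  bP := P.b 3
  hbox := fun i => by
    have h12 : P.a 2 i < P.a 1 i ∧ P.b 1 i < P.b 2 i := P.corner_lt 1 i
    have h23 : P.a 3 i < P.a 2 i ∧ P.b 2 i < P.b 3 i := P.corner_lt 2 i
    exact ⟨h23.1.trans h12.1, P.hab 1 i, h12.2.trans h23.2⟩
  hmargin := by
    have hε := (eps_spec st P k hinv).2.1
    have h34 : cthickening P.η (P.B 3) ⊆ P.B 4 := P.cthickening_B_subset 3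
    exact (cthickening_mono (by show 2 * eps st P k hinv ≤ P.η; linarith [P.hη]) _).trans h34

end Input

/-! ### Affine helpers -/

section AffineHelpers

variable {W V : Type*} [NormedAddCommGroup W] [NormedSpace ℝ W] [NormedAddCommGroup V] [NormedSpace ℝ V]

/-- **An affine map injective on a closed simplex has linear part injective on its direction
space.** [folklore] -/
theorem linear_eq_zero_of_injOn_convexHull {t : Finset W} (A : W →ᵃ[ℝ] V)
    (hinj : InjOn A (convexHull ℝ (t : Set W))) {u : W} (hu : u ∈ vectorSpan ℝ (t : Set W))
    (h0 : A.linear u = 0) : u = 0 := by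
  classical
  rcases t.eq_empty_or_nonempty with rfl | hne
  · simp only [Finset.coe_empty, vectorSpan_empty, Submodule.mem_bot] at hu; exact hu
  obtain ⟨c, hc0, hcu⟩ := exists_balanced_of_mem_vectorSpan hu
  -- a small step from the barycentre in direction `u` stays in the simplex
  set τ : ℝ := (t.card : ℝ)⁻¹ / (1 + ∑ v ∈ t, |c v|) with hτ
  have hpos : 0 < 1 + ∑ v ∈ t, |c v| := by positivity
  have hτ0 : 0 < τ := by rw [hτ]; have := hne.card_pos; positivity
  have hτle : ∀ v ∈ t, τ * |c v| ≤ (t.card : ℝ)⁻¹ := fun v hv => by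
    rw [hτ, div_mul_eq_mul_div, div_le_iff₀ hpos]
    refine mul_le_mul_of_nonneg_left ?_ (by positivity)
    have : |c v| ≤ ∑ w ∈ t, |c w| := Finset.single_le_sum (f := fun w => |c w|) (fun _ _ => abs_nonneg _) hv
    linarith
  have hmem : bary t + τ • u ∈ convexHull ℝ (t : Set W) := by
    rw [← hcu]; exact bary_add_smul_mem_convexHull hne hc0 hτ0.le hτle
  have hb : bary t ∈ convexHull ℝ (t : Set W) := bary_mem_convexHull hne
  have hA : A (bary t + τ • u) = A (bary t) := by
    have h := A.map_vadd (bary t) (τ • u)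
    rw [vadd_eq_add, vadd_eq_add, add_comm] at h
    rw [h, map_smul, h0, smul_zero, zero_add]
  have heq := hinj hmem hb hA
  have : τ • u = 0 := by
    have h2 : bary t + τ • u - bary t = 0 := by rw [heq, sub_self]
    rwa [add_sub_cancel_left] at h2
  rcases smul_eq_zero.1 this with h | h
  · exact absurd h hτ0.ne'
  · exact h

/-- Differences of points of a closed simplex lie in the direction space. [folklore] -/
theorem sub_mem_vectorSpan {t : Finset W} {x y : W} (hx : x ∈ convexHull ℝ (t : Set W))
    (hy : y ∈ convexHull ℝ (t : Set W)) : x - y ∈ vectorSpan ℝ (t : Set W) := by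
  rw [← direction_affineSpan]
  exact AffineSubspace.vsub_mem_direction (convexHull_subset_affineSpan _ hx) (convexHull_subset_affineSpan _ hy)

/-- **The linear part maps direction spaces along an inclusion of closed simplices.** [folklore] -/
theorem linear_mem_vectorSpan {W' : Type*} [NormedAddCommGroup W'] [NormedSpace ℝ W'] {t : Finset W}
    {s : Finset W'} (B : W →ᵃ[ℝ] W') (h : B '' convexHull ℝ (t : Set W) ⊆ convexHull ℝ (s : Set W'))
    {u : W} (hu : u ∈ vectorSpan ℝ (t : Set W)) : B.linear u ∈ vectorSpan ℝ (s : Set W') := by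
  classical
  rcases t.eq_empty_or_nonempty with rfl | ⟨p₀, hp₀⟩
  · simp only [Finset.coe_empty, vectorSpan_empty, Submodule.mem_bot] at hu
    rw [hu, map_zero]; exact Submodule.zero_mem _
  obtain ⟨c, hc0, hcu⟩ := exists_balanced_of_mem_vectorSpan hu
  have hu' : u = ∑ v ∈ t, c v • (v - p₀) := by
    rw [← hcu]; simp only [smul_sub, Finset.sum_sub_distrib, ← Finset.sum_smul, hc0, zero_smul, sub_zero]
  rw [hu', map_sum]
  refine Submodule.sum_mem _ fun v hv => ?_
  rw [map_smul]
  refine Submodule.smul_mem _ _ ?_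
  have h1 : B.linear (v - p₀) = B v - B p₀ := B.linearMap_vsub v p₀
  rw [h1]
  exact sub_mem_vectorSpan (h ⟨v, subset_convexHull ℝ _ hv, rfl⟩) (h ⟨p₀, subset_convexHull ℝ _ hp₀, rfl⟩)

/-- **Affine left inverses on a closed simplex.** An affine map injective on a closed simplex has
an affine left inverse there. [folklore] -/
theorem exists_affine_leftInv [FiniteDimensional ℝ W] [FiniteDimensional ℝ V] {t : Finset W} (A : W →ᵃ[ℝ] V)
    (hinj : InjOn A (convexHull ℝ (t : Set W))) :
    ∃ L : V →ᵃ[ℝ] W, ∀ x ∈ convexHull ℝ (t : Set W), L (A x) = x := by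
  classical
  rcases t.eq_empty_or_nonempty with rfl | ⟨p₀, hp₀⟩
  · exact ⟨0, fun x hx => by simp at hx⟩
  set V₀ : Submodule ℝ W := vectorSpan ℝ (t : Set W) with hV₀
  set R : V₀ →ₗ[ℝ] V := A.linear.comp V₀.subtype with hR
  have hRinj : LinearMap.ker R = ⊥ := by
    rw [LinearMap.ker_eq_bot']
    intro u hu
    have : (u : W) = 0 := linear_eq_zero_of_injOn_convexHull A hinj u.2 hu
    exact Subtype.ext this
  obtain ⟨g, hg⟩ := R.exists_leftInverse_of_injective hRinj
  set L' : V →ₗ[ℝ] W := V₀.subtype.comp g with hL'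
  refine ⟨L'.toAffineMap + AffineMap.const ℝ V (p₀ - L' (A p₀)), fun x hx => ?_⟩
  have hxp : x - p₀ ∈ V₀ := sub_mem_vectorSpan hx (subset_convexHull ℝ _ hp₀)
  have hAx : A x - A p₀ = A.linear (x - p₀) := (A.linearMap_vsub x p₀).symm
  have hL'A : L' (A.linear (x - p₀)) = x - p₀ := by
    have h1 : A.linear (x - p₀) = R ⟨x - p₀, hxp⟩ := rfl
    have h2 := LinearMap.congr_fun hg ⟨x - p₀, hxp⟩
    simp only [LinearMap.comp_apply, LinearMap.id_apply] at h2
    rw [h1, hL', LinearMap.comp_apply, h2]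
    rfl
  show L' (A x) + (p₀ - L' (A p₀)) = x
  have : L' (A x) = L' (A x - A p₀) + L' (A p₀) := by rw [← map_add, sub_add_cancel]
  rw [this, hAx, hL'A]
  abel

/-- Affine maps on finite-dimensional spaces are `C^∞`. [folklore] -/
theorem contDiff_affineMap [FiniteDimensional ℝ W] (B : W →ᵃ[ℝ] V) : ContDiff ℝ ∞ B := by
  have h : (B : W → V) = fun y => LinearMap.toContinuousLinearMap B.linear y + B 0 := by
    funext y
    have := B.map_vadd 0 y
    rw [vadd_eq_add, add_zero] at this
    rw [this, vadd_eq_add]; rfl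
  rw [h]
  exact (LinearMap.toContinuousLinearMap B.linear).contDiff.add contDiff_const

end AffineHelpers

/-! ### Smooth chart models of the new state -/

section Models

variable {n : ℕ} {M : Type*} [TopologicalSpace M] [T2Space M] [ChartedSpace (EuclideanSpace ℝ (Fin n)) M]
  [IsManifold (𝓡 n) ∞ M]
  (st : TriState n M) (P : Piece n M) (k : ℕ) (hinv : ∀ j < k, ChartInv st j)

/-- The chart transition `e.symm ≫ e'` of two charts of the atlas is `C^∞` with injective
derivative on its source. [folklore] -/
theorem transition_smooth {e e' : OpenPartialHomeomorph M (𝔼 n)} (he : e ∈ atlas (𝔼 n) M)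
    (he' : e' ∈ atlas (𝔼 n) M) :
    ContDiffOn ℝ ∞ (e.symm ≫ₕ e') (e.symm ≫ₕ e').source ∧
      ∀ z ∈ (e.symm ≫ₕ e').source, Injective (fderiv ℝ (e.symm ≫ₕ e') z) := by
  have hmem : e.symm ≫ₕ e' ∈ contDiffGroupoid ∞ (𝓡 n) := StructureGroupoid.compatible _ he he'
  exact ⟨(contDiffOn_of_mem_contDiffGroupoid_euclidean hmem).1,
    fun z hz => injective_fderiv_of_mem_contDiffGroupoid hmem hz⟩

/-- **Transport of a model along an affine parametrisation and a chart transition.** If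
`e ∘ g = Gm ∘ B`-data: precisely, if on the set `T` we have `g y ∈ e.source` and
`e (g y) = Gm (B y)` with `Gm` smooth on an open `O ∋ B y` and `D Gm (B y)` injective on the
directions `B.linear u` (`u` in a subspace `Dir` on which `B.linear` is injective), then for
every chart `e'` of the atlas, `e' ∘ g` has a smooth model on an open set containing
`T ∩ g ⁻¹' e'.source`, with derivative injective on `Dir`. [folklore] -/
theorem hasModel_transport {N' : ℕ} {W'' : Type*} [NormedAddCommGroup W''] [NormedSpace ℝ W'']
    {g : (Fin N' → ℝ) → M} {T : Set (Fin N' → ℝ)}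
    {e e' : OpenPartialHomeomorph M (𝔼 n)} (he : e ∈ atlas (𝔼 n) M) (he' : e' ∈ atlas (𝔼 n) M)
    (B : (Fin N' → ℝ) →ᵃ[ℝ] W'') {O : Set W''} (hO : IsOpen O) {Gm : W'' → 𝔼 n}
    (hGm : ContDiffOn ℝ ∞ Gm O) (hBO : ∀ y ∈ T, B y ∈ O)
    (hg : ∀ y ∈ T, g y ∈ e.source ∧ e (g y) = Gm (B y)) (Dir : Submodule ℝ (Fin N' → ℝ))
    (hBinj : ∀ u ∈ Dir, B.linear u = 0 → u = 0)
    (hGinj : ∀ y ∈ T, ∀ u ∈ Dir, fderiv ℝ Gm (B y) (B.linear u) = 0 → B.linear u = 0) :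
    ∃ O' : Set (Fin N' → ℝ), ∃ G' : (Fin N' → ℝ) → 𝔼 n, IsOpen O' ∧ T ∩ g ⁻¹' e'.source ⊆ O' ∧
      ContDiffOn ℝ ∞ G' O' ∧ EqOn (e' ∘ g) G' (T ∩ g ⁻¹' e'.source) ∧
      ∀ y ∈ T ∩ g ⁻¹' e'.source, ∀ u ∈ Dir, fderiv ℝ G' y u = 0 → u = 0 := by
  obtain ⟨hTs, hTinj⟩ := transition_smooth he he'
  set Tr := e.symm ≫ₕ e' with hTr
  -- the open set and the model
  have hO₁ : IsOpen (O ∩ Gm ⁻¹' Tr.source) := hGm.continuousOn.isOpen_inter_preimage hO Tr.open_source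
  have hBc : Continuous B := B.continuous_of_finiteDimensional
  refine ⟨B ⁻¹' (O ∩ Gm ⁻¹' Tr.source), fun y => Tr (Gm (B y)), hO₁.preimage hBc, ?_, ?_, ?_, ?_⟩
  · rintro y ⟨hyT, hye'⟩
    obtain ⟨hsrc, heq⟩ := hg y hyT
    refine ⟨hBO y hyT, ?_⟩
    show Gm (B y) ∈ Tr.source
    rw [hTr, OpenPartialHomeomorph.trans_source, e.symm_source, ← heq]
    exact ⟨e.map_source hsrc, by show e.symm (e (g y)) ∈ e'.source; rw [e.left_inv hsrc]; exact hye'⟩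
  · -- smoothness: composition
    have h1 : ContDiffOn ℝ ∞ (fun y => Gm (B y)) (B ⁻¹' (O ∩ Gm ⁻¹' Tr.source)) :=
      hGm.comp (contDiff_affineMap B).contDiffOn fun y hy => hy.1
    exact hTs.comp h1 fun y hy => hy.2
  · rintro y ⟨hyT, hye'⟩
    obtain ⟨hsrc, heq⟩ := hg y hyT
    show e' (g y) = Tr (Gm (B y))
    rw [hTr, OpenPartialHomeomorph.trans_apply, ← heq, e.left_inv hsrc]
  · rintro y ⟨hyT, hye'⟩ u hu h0
    obtain ⟨hsrc, heq⟩ := hg y hyT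
    have hz : Gm (B y) ∈ Tr.source := by
      rw [hTr, OpenPartialHomeomorph.trans_source, e.symm_source, ← heq]
      exact ⟨e.map_source hsrc, by show e.symm (e (g y)) ∈ e'.source; rw [e.left_inv hsrc]; exact hye'⟩
    -- chain rule
    have hdB : HasFDerivAt B (LinearMap.toContinuousLinearMap B.linear) y := hasFDerivAt_affineMap B y
    have hdG : HasFDerivAt Gm (fderiv ℝ Gm (B y)) (B y) :=
      ((hGm.contDiffAt (hO.mem_nhds (hBO y hyT))).differentiableAt (by simp)).hasFDerivAt
    have hdT : HasFDerivAt Tr (fderiv ℝ Tr (Gm (B y))) (Gm (B y)) :=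
      ((hTs.contDiffAt (Tr.open_source.mem_nhds hz)).differentiableAt (by simp)).hasFDerivAt
    have hcomp : HasFDerivAt (fun y => Tr (Gm (B y)))
        ((fderiv ℝ Tr (Gm (B y))).comp ((fderiv ℝ Gm (B y)).comp (LinearMap.toContinuousLinearMap B.linear))) y :=
      hdT.comp y (hdG.comp y hdB)
    rw [hcomp.fderiv] at h0
    simp only [ContinuousLinearMap.coe_comp, Function.comp_apply, LinearMap.coe_toContinuousLinearMap'] at h0
    have h1 : fderiv ℝ Gm (B y) (B.linear u) = 0 := hTinj _ hz (by rw [h0, map_zero])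
    exact hBinj u hu (hGinj y hyT u hu h1)

/-- Injectivity of the linear part of an affine parametrisation of a closed simplex read off from
an injective map factoring through it. [folklore] -/
theorem linear_eq_zero_of_factor {N₁ : ℕ} {W'' : Type*} [NormedAddCommGroup W''] [NormedSpace ℝ W'']
    {K : Geometry.SimplicialComplex ℝ (Fin N₁ → ℝ)} {g : (Fin N₁ → ℝ) → M} (hg : InjOn g K.space)
    {τ : Finset (Fin N₁ → ℝ)} (hτ : τ ∈ K.faces) (B : (Fin N₁ → ℝ) →ᵃ[ℝ] W'') (φ : W'' → M)
    (hφ : ∀ y ∈ convexHull ℝ (τ : Set (Fin N₁ → ℝ)), g y = φ (B y)) :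
    ∀ u ∈ vectorSpan ℝ (τ : Set (Fin N₁ → ℝ)), B.linear u = 0 → u = 0 := by
  intro u hu h0
  refine linear_eq_zero_of_injOn_convexHull B (fun y hy y' hy' hB => ?_) hu h0
  exact hg (K.convexHull_subset_space hτ hy) (K.convexHull_subset_space hτ hy') (by rw [hφ y hy, hφ y' hy', hB])

/-- **Smooth chart models of the new state** on its top simplices, for every chart of the atlas
(for any set-up and extension input of the stage). [folklore] -/
theorem next_model (S : (bendInput st P k hinv).BendSetup) (X : S.ExtInput) :
    ∀ τ ∈ X.K₃c.faces, τ.card = n + 1 → ∀ e' ∈ atlas (𝔼 n) M, HasModel n M X.f₃c τ e' := by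
  intro τ hτ hcard e' he'
  have hPe : (bendInput st P k hinv).e ∈ atlas (𝔼 n) M := P.he
  rcases X.simplex_cases hτ with ⟨σ, hσ, rfl⟩ | ⟨ρ, hρ, rfl⟩
  · -- an old simplex: `f₃c = f' ∘ B`
    obtain ⟨B, hBimg, hfB⟩ := X.old_simplex hσ
    have hσK : σ ∈ S.Kb.faces := hσ.1
    have hcardσ : σ.card = n + 1 := by
      rw [← hcard, X.card_coordSimplex', X.card_idx (X.oldFace_mem_G₃ hσ), BendInput.BendSetup.ExtInput.card_oldFace]
    have hσP : σ ∈ S.PTop := ⟨hσK.1, hcardσ⟩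
    have hBmem : ∀ y ∈ convexHull ℝ ((coordSimplex (idx X.vtx (S.oldFace σ)) : Finset (Fin X.N₃ → ℝ)) : Set (Fin X.N₃ → ℝ)),
        B y ∈ convexHull ℝ (σ : Set (Fin st.N → ℝ)) := fun y hy => by rw [← hBimg]; exact ⟨y, hy, rfl⟩
    have hBinj := linear_eq_zero_of_factor X.injOn_f₃c hτ B S.fbend hfB
    rcases S.active_or_unbent hσK.1 with ⟨s, hs, hσs, hσZ⟩ | hunbent
    · -- active: the bent model, then the chart transition
      obtain ⟨hOo, hσO, hBt, hfb, hDinj⟩ := S.model_active hs hσP hσs hσZ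
      obtain ⟨O', G', hO', hsub, hG', hEq, hD'⟩ := hasModel_transport (g := X.f₃c) (T := convexHull ℝ _) hPe he' B hOo hBt
        (fun y hy => hσO (hBmem y hy))
        (fun y hy => by rw [hfB y hy]; exact hfb (B y) (hBmem y hy)) (vectorSpan ℝ _) hBinj
        (fun y hy u hu h0 => hDinj (B y) (hBmem y hy) (B.linear u)
          (linear_mem_vectorSpan B (by rw [hBimg]) hu) h0)
      exact ⟨⟨O', G', hO', hsub, hG', hEq, hD'⟩⟩
    · -- unbent: the old model of the top simplex of `K` containing `σ`, for the chart `e'`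
      obtain ⟨s, hs, hσs⟩ := S.exists_top_of_mem_P hσK.1
      obtain ⟨O, G, hO, hsO, hG, hEqG, hDG⟩ := (st.model s hs.1 hs.2 e' he').out
      have hTf : ∀ y ∈ convexHull ℝ ((coordSimplex (idx X.vtx (S.oldFace σ)) : Finset (Fin X.N₃ → ℝ)) :
          Set (Fin X.N₃ → ℝ)) ∩ X.f₃c ⁻¹' e'.source,
          st.f (B y) = X.f₃c y ∧ B y ∈ convexHull ℝ (s : Set (Fin st.N → ℝ)) := fun y hy => by
        have hBy := hBmem y hy.1
        exact ⟨by rw [hfB y hy.1]; exact (hunbent hBy).symm, hσs hBy⟩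
      obtain ⟨O', G', hO', hsub, hG', hEq, hD'⟩ := hasModel_transport (g := X.f₃c)
        (T := convexHull ℝ ((coordSimplex (idx X.vtx (S.oldFace σ)) : Finset (Fin X.N₃ → ℝ)) : Set (Fin X.N₃ → ℝ)) ∩
          X.f₃c ⁻¹' e'.source) he' he' B hO hG
        (fun y hy => hsO ⟨(hTf y hy).2, by show st.f (B y) ∈ e'.source; rw [(hTf y hy).1]; exact hy.2⟩)
        (fun y hy => by
          obtain ⟨hfy, hBs⟩ := hTf y hy
          refine ⟨hy.2, ?_⟩
          rw [← hfy]
          exact hEqG ⟨hBs, by show st.f (B y) ∈ e'.source; rw [hfy]; exact hy.2⟩)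
        (vectorSpan ℝ _) hBinj
        (fun y hy u hu h0 => by
          obtain ⟨hfy, hBs⟩ := hTf y hy
          exact hDG (B y) ⟨hBs, by show st.f (B y) ∈ e'.source; rw [hfy]; exact hy.2⟩ (B.linear u)
            (linear_mem_vectorSpan B (hBimg.symm ▸ hσs) hu) h0)
      rw [Set.inter_assoc, Set.inter_self] at hsub hEq hD'
      exact ⟨⟨O', G', hO', hsub, hG', hEq, hD'⟩⟩
  · -- a new simplex: `e ∘ f₃c = A`
    obtain ⟨A, hA, -, -⟩ := X.new_simplex hρ
    have hAinj := linear_eq_zero_of_factor X.injOn_f₃c hτ A (fun z => (bendInput st P k hinv).e.symm z) (fun y hy => by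
      obtain ⟨hsrc, heq⟩ := hA y hy
      rw [← heq, (bendInput st P k hinv).e.left_inv hsrc])
    obtain ⟨O', G', hO', hsub, hG', hEq, hD'⟩ := hasModel_transport (g := X.f₃c) (T := convexHull ℝ _) hPe he' A isOpen_univ
      (Gm := id) contDiff_id.contDiffOn (fun _ _ => mem_univ _) (fun y hy => hA y hy) (vectorSpan ℝ _) hAinj
      (fun y _ u _ h0 => by rwa [fderiv_id, ContinuousLinearMap.id_apply] at h0)
    exact ⟨⟨O', G', hO', hsub, hG', hEq, hD'⟩⟩

end Models

/-! ### The new state -/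

section Next

variable {n : ℕ} {M : Type*} [TopologicalSpace M] [T2Space M] [ChartedSpace (EuclideanSpace ℝ (Fin n)) M]
  [IsManifold (𝓡 n) ∞ M]
  (st : TriState n M) (P : Piece n M) (k : ℕ) (hinv : ∀ j < k, ChartInv st j)

/-- A chart is *untouched* by the stage if its birth region avoids the last box of the piece.
(A `Prop`-valued structure: bookkeeping, not a named fact.) [folklore] -/
structure Untouched (j : ℕ) : Prop where
  /-- the birth region avoids the last box -/
  eq : st.D j ∩ P.e.symm '' P.B 7 = ∅

open Classical in
/-- **The new state after the stage** (Munkres 10.5): the canonical complex and map of the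
extension step; the old charts are transported by the comparison map `Ψ` (and lose the inner box)
unless untouched; the new chart is `e` on `e.symm '' (open outer box) ∩ interior (image)`.
[folklore] -/
def next : TriState n M where
  N := (extInput st P k hinv).N₃
  K := (extInput st P k hinv).K₃c
  hK := (extInput st P k hinv).isCoordinate_K₃c
  pure := fun _ hr => (extInput st P k hinv).K₃c_pure hr
  f := (extInput st P k hinv).f₃c
  inj := (extInput st P k hinv).injOn_f₃c
  cont := fun _ hs => (extInput st P k hinv).continuousOn_f₃c hs
  model := next_model st P k hinv (setup st P k hinv) (extInput st P k hinv)
  D := fun j => if j < k then st.D j else if j = k then P.e.symm '' openBox (P.a 3) (P.b 3) else ∅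
  W := fun j => if j < k then
      (if Untouched st P j then st.W j
       else ((setup st P k hinv).Ψ '' (st.W j ∩ (setup st P k hinv).V) \ P.e.symm '' P.B 1) ∩ st.D j)
    else if j = k then P.e.symm '' openBox (P.a 3) (P.b 3) ∩
      interior ((extInput st P k hinv).f₃c '' (extInput st P k hinv).K₃c.space)
    else ∅
  φ := fun j => if j < k then (if Untouched st P j then st.φ j else st.φ j ∘ (setup st P k hinv).Ψinv) else P.e
  C' := fun j => if j < k then
      (if Untouched st P j then st.C' j else st.C' j \ P.e.symm '' openBox (P.a 2) (P.b 2))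
    else if j = k then P.e.symm '' P.B 2 ∩ (prot st k ∪ P.Cpiece) else ∅

/-! ### Unfolding the new state -/

/-- Auxiliary (`next_f`). [folklore] -/
theorem next_f : (next st P k hinv).f = (extInput st P k hinv).f₃c := rfl

/-- Auxiliary (`next_K`). [folklore] -/
theorem next_K : (next st P k hinv).K = (extInput st P k hinv).K₃c := rfl

/-- Auxiliary (`next_W_new`). [folklore] -/
theorem next_W_new : (next st P k hinv).W k = P.e.symm '' openBox (P.a 3) (P.b 3) ∩
    interior ((extInput st P k hinv).f₃c '' (extInput st P k hinv).K₃c.space) := by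
  simp [next]

/-- Auxiliary (`next_φ_new`). [folklore] -/
theorem next_φ_new : (next st P k hinv).φ k = P.e := by simp [next]

/-- Auxiliary (`next_C'_new`). [folklore] -/
theorem next_C'_new : (next st P k hinv).C' k = P.e.symm '' P.B 2 ∩ (prot st k ∪ P.Cpiece) := by simp [next]

/-- Auxiliary (`next_D_new`). [folklore] -/
theorem next_D_new : (next st P k hinv).D k = P.e.symm '' openBox (P.a 3) (P.b 3) := by simp [next]

/-- Auxiliary (`next_W_gt`). [folklore] -/
theorem next_W_gt {j : ℕ} (hj : k < j) : (next st P k hinv).W j = ∅ := by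
  simp [next, Nat.lt_asymm hj, hj.ne']

/-- Auxiliary (`next_C'_gt`). [folklore] -/
theorem next_C'_gt {j : ℕ} (hj : k < j) : (next st P k hinv).C' j = ∅ := by
  simp [next, Nat.lt_asymm hj, hj.ne']

/-- Auxiliary (`next_D_gt`). [folklore] -/
theorem next_D_gt {j : ℕ} (hj : k < j) : (next st P k hinv).D j = ∅ := by
  simp [next, Nat.lt_asymm hj, hj.ne']

/-- Auxiliary (`next_untouched`). [folklore] -/
theorem next_untouched {j : ℕ} (hj : j < k) (hu : Untouched st P j) :
    (next st P k hinv).W j = st.W j ∧ (next st P k hinv).φ j = st.φ j ∧ (next st P k hinv).C' j = st.C' j ∧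
      (next st P k hinv).D j = st.D j := by
  simp [next, hj, hu]

/-- Auxiliary (`next_touched`). [folklore] -/
theorem next_touched {j : ℕ} (hj : j < k) (hu : ¬Untouched st P j) :
    (next st P k hinv).W j = ((setup st P k hinv).Ψ '' (st.W j ∩ (setup st P k hinv).V) \ P.e.symm '' P.B 1) ∩ st.D j ∧
    (next st P k hinv).φ j = st.φ j ∘ (setup st P k hinv).Ψinv ∧
    (next st P k hinv).C' j = st.C' j \ P.e.symm '' openBox (P.a 2) (P.b 2) ∧
    (next st P k hinv).D j = st.D j := by
  simp [next, hj, hu]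

end Next


/-! ## Part C: the invariants of the new state -/

section Inv

variable {n : ℕ} {M : Type*} [TopologicalSpace M] [T2Space M] [ChartedSpace (EuclideanSpace ℝ (Fin n)) M]
  [IsManifold (𝓡 n) ∞ M]
  (st : TriState n M) (P : Piece n M) (k : ℕ) (hinv : ∀ j < k, ChartInv st j)

/-! ### Generic facts about the bending data of the stage -/

/-- The bent map moves a point only into `e.symm '' R₄`. [folklore] -/
theorem fbend_eq_or (S : (bendInput st P k hinv).BendSetup) (x : Fin st.N → ℝ) :
    S.fbend x = st.f x ∨ (x ∈ (bendInput st P k hinv).D ∧ S.fbend x ∈ P.e.source ∧ P.e (S.fbend x) = S.Bmap x ∧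
      S.Bmap x ∈ P.B 7 ∧ (bendInput st P k hinv).F x ∈ P.B 6) := by
  by_cases hx : x ∈ (bendInput st P k hinv).D
  · obtain ⟨hsrc, heq⟩ := S.fbend_mem_source hx
    rcases (S.Bmap_mem hx).2 with h | ⟨h3, h4⟩
    · left
      rw [S.fbend_of_mem hx, h]
      exact P.e.left_inv hx.2
    · exact Or.inr ⟨hx, hsrc, heq, h4, h3⟩
  · exact Or.inl (S.fbend_of_notMem hx)

/-- Chart invariants of empty data. [folklore] -/
theorem chartInv_empty (st' : TriState n M) (j : ℕ) (hW : st'.W j = ∅) (hC : st'.C' j = ∅) (hD : st'.D j = ∅) :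
    ChartInv st' j where
  isOpen := by rw [hW]; exact isOpen_empty
  isOpenD := by rw [hD]; exact isOpen_empty
  subsetD := by rw [hW]; exact empty_subset _
  subset := by rw [hW]; exact empty_subset _
  inj := by rw [hW]; exact injOn_empty _
  cont := by rw [hW]; exact continuousOn_empty _
  openMap := fun U hU _ => by
    rw [hW, subset_empty_iff] at hU
    rw [hU, image_empty]; exact isOpen_empty
  affine := fun s _ => ⟨0, fun x hx => by rw [hW] at hx; exact hx.2.elim⟩
  compact := by rw [hC]; exact isCompact_empty
  core := by rw [hC]; exact empty_subset _

/-! ### The new chart -/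

/-- **The new chart satisfies the invariants.** [folklore] -/
theorem chartInv_next_new : ChartInv (next st P k hinv) k := by
  have hWk := next_W_new st P k hinv
  have hφk := next_φ_new st P k hinv
  have hCk := next_C'_new st P k hinv
  have hDk := next_D_new st P k hinv
  have hopen₃ : IsOpen (P.e.symm '' openBox (P.a 3) (P.b 3)) :=
    P.e.symm.isOpen_image_of_subset_source (isOpen_openBox _ _)
      (by rw [P.e.symm_source]; exact (openBox_subset_box _ _).trans (P.B_subset_target 3))
  have hsrc₃ : P.e.symm '' openBox (P.a 3) (P.b 3) ⊆ P.e.source := by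
    rintro _ ⟨z, hz, rfl⟩; exact P.e.map_target (P.B_subset_target 3 (openBox_subset_box _ _ hz))
  refine ⟨?_, ?_, ?_, ?_, ?_, ?_, ?_, ?_, ?_, ?_⟩
  · rw [hWk]; exact hopen₃.inter isOpen_interior
  · rw [hDk]; exact hopen₃
  · rw [hWk, hDk]; exact inter_subset_left
  · rw [hWk]; exact inter_subset_right.trans interior_subset
  · rw [hWk, hφk]; exact P.e.injOn.mono (inter_subset_left.trans hsrc₃)
  · rw [hWk, hφk]; exact P.e.continuousOn.mono (inter_subset_left.trans hsrc₃)
  · intro U hU hUo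
    rw [hφk]
    rw [hWk] at hU
    exact P.e.isOpen_image_of_subset_source hUo (hU.trans (inter_subset_left.trans hsrc₃))
  · intro τ hτ
    rw [hφk, hWk]
    by_cases hmeet : ((extInput st P k hinv).f₃c '' convexHull ℝ (τ : Set (Fin (next st P k hinv).N → ℝ)) ∩
        P.e.symm '' openBox (P.a 3) (P.b 3)).Nonempty
    · obtain ⟨A, hA⟩ := (extInput st P k hinv).straight_stage hτ hmeet
      exact ⟨A, fun y hy => (hA y hy.1).2⟩
    · refine ⟨0, fun y hy => ?_⟩
      exact (hmeet ⟨_, ⟨y, hy.1, rfl⟩, hy.2.1⟩).elim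
  · rw [hCk]
    refine ((P.isCompact_B 2).image_of_continuousOn (P.e.continuousOn_symm.mono (P.B_subset_target 2))).inter_right ?_
    exact ((isCompact_prot st k hinv).union P.isCompact_Cpiece).isClosed
  · rw [hCk, hWk]
    rintro p ⟨⟨z, hz, rfl⟩, hp⟩
    refine ⟨⟨z, P.B_subset_openBox 2 hz, rfl⟩, ?_⟩
    -- interior: a neighbourhood inside the image
    have himg := (extInput st P k hinv).f₃c_image
    rcases hp with hp | ⟨z₀, hz₀, hzz₀⟩
    · obtain ⟨U, hUo, hpU, hUsub⟩ := (setup st P k hinv).exists_open_subset_image (p := P.e.symm z) hp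
      rw [mem_interior]
      exact ⟨U, fun q hq => by rw [himg]; exact Or.inl (hUsub hq), hUo, hpU⟩
    · rw [mem_interior]
      refine ⟨P.e.symm '' openBox (P.a 1) (P.b 1), ?_, ?_, ?_⟩
      · rintro _ ⟨w, hw, rfl⟩
        rw [himg]
        exact Or.inr ⟨w, openBox_subset_box _ _ hw, rfl⟩
      · exact P.e.symm.isOpen_image_of_subset_source (isOpen_openBox _ _)
          (by rw [P.e.symm_source]; exact (openBox_subset_box _ _).trans (P.B_subset_target 1))
      · rw [← hzz₀]
        exact ⟨z₀, P.B_subset_openBox 0 hz₀, rfl⟩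

/-! ### Where the bent map can move points, and the images of new simplices -/

/-- `Mhalf ⊆ e.symm '' B₇`. [folklore] -/
theorem mhalf_subset : (bendInput st P k hinv).Mhalf ⊆ P.e.symm '' P.B 7 := by
  rintro _ ⟨x, hx, rfl⟩
  obtain ⟨-, y, hy, hyx⟩ := hx
  exact ⟨y, (bendInput st P k hinv).half_subset_R₄ hy, hyx⟩

/-- A moved point lies in `e.symm '' B₇`. [folklore] -/
theorem fbend_mem_of_ne (S : (bendInput st P k hinv).BendSetup) {x : Fin st.N → ℝ} (hx : S.fbend x ≠ st.f x) :
    S.fbend x ∈ P.e.symm '' P.B 7 := by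
  rcases fbend_eq_or st P k hinv S x with h | ⟨-, hsrc, heq, h7, -⟩
  · exact absurd h hx
  · exact ⟨S.Bmap x, h7, by rw [← heq, P.e.left_inv hsrc]⟩

/-- **Images of new simplices lie in `e.symm '' B₇`.** [folklore] -/
theorem new_image_subset (S : (bendInput st P k hinv).BendSetup) (X : S.ExtInput) (hXa : X.a₀ = P.a 1) (hXb : X.b₀ = P.b 1)
    {ρ : Finset (𝔼 n)} (hρ : ρ ∈ X.H.faces) :
    X.f₃c '' convexHull ℝ ((coordSimplex (idx X.vtx (S.newFace ρ)) : Finset (Fin X.N₃ → ℝ)) : Set (Fin X.N₃ → ℝ)) ⊆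
      P.e.symm '' P.B 7 := by
  obtain ⟨A, hA, hAimg, hinside⟩ := X.new_simplex hρ
  rintro _ ⟨y, hy, rfl⟩
  obtain ⟨hsrc, heq⟩ := hA y hy
  rw [bendInput_e] at hsrc heq
  have hAy : A y ∈ convexHull ℝ (ρ : Set (𝔼 n)) := by rw [← hAimg]; exact ⟨y, hy, rfl⟩
  refine ⟨A y, ?_, by rw [← heq, P.e.left_inv hsrc]⟩
  rcases hinside with hbox | ⟨u₀, hu₀, hsub⟩
  · have h : A y ∈ X.R₀ := hbox hAy
    have h1 : X.R₀ = P.B 1 := by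
      show box X.a₀ X.b₀ = box (P.a 1) (P.b 1); rw [hXa, hXb]
    rw [h1] at h
    exact P.B_mono (by decide) h
  · obtain ⟨x, hx, hxy⟩ := hsub hAy
    obtain ⟨hxs, hxe, hxΛ⟩ := S.straight hu₀.1.1 hu₀.2 hx
    rw [← hxy, hxΛ, ← hxe]
    rcases fbend_eq_or st P k hinv S x with h | ⟨-, -, heq', h7, -⟩
    · -- unmoved: `Λ x = e (f x) = F x ∈ R₂`
      have hx2 : (bendInput st P k hinv).F x ∈ (bendInput st P k hinv).R₂ :=
        (((bendInput st P k hinv).mem_zone_iff_F (bendInput st P k hinv).R₂t).1 (hu₀.2 hx)).2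
      rw [h]
      exact P.B_mono (by decide) hx2
    · have heq'' : (bendInput st P k hinv).e (S.fbend x) = S.Bmap x := heq'
      rw [heq'']
      exact h7

/-! ### Untouched old charts -/

/-- **An untouched old chart keeps its invariants.** [folklore] -/
theorem chartInv_next_untouched {j : ℕ} (hj : j < k) (hu : Untouched st P j) : ChartInv (next st P k hinv) j := by
  have h := hinv j hj
  obtain ⟨hW, hφ, hC, hD⟩ := next_untouched st P k hinv hj hu
  set S := setup st P k hinv with hS
  set X := extInput st P k hinv with hX
  -- no point of `W j` is moved, and `W j ⊆ f' '' K''.space`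
  have hdisj : ∀ p ∈ st.W j, p ∉ P.e.symm '' P.B 7 := fun p hp hp7 => by
    have : p ∈ st.D j ∩ P.e.symm '' P.B 7 := ⟨h.subsetD hp, hp7⟩
    rw [hu.eq] at this
    exact this
  have hWsub : st.W j ⊆ S.fbend '' S.Kb.space := fun p hp => by
    obtain ⟨x, hxK, rfl⟩ := h.subset hp
    obtain ⟨t, ht, hxt⟩ := S.exists_PTop_of_mem_space hxK
    have hfar : st.f x ∉ (bendInput st P k hinv).Mhalf := fun hm => hdisj _ hp (mhalf_subset st P k hinv hm)
    obtain ⟨hkept, hunb⟩ := S.kept_of_notMem_Mhalf ht hxt hfar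
    exact ⟨x, S.Kb.convexHull_subset_space (S.mem_Kb_of_keptTop hkept) hxt, hunb hxt⟩
  refine ⟨?_, ?_, ?_, ?_, ?_, ?_, ?_, ?_, ?_, ?_⟩
  · rw [hW]; exact h.isOpen
  · rw [hD]; exact h.isOpenD
  · rw [hW, hD]; exact h.subsetD
  · rw [hW]
    show st.W j ⊆ X.f₃c '' X.K₃c.space
    rw [X.f₃c_image]
    exact hWsub.trans subset_union_left
  · rw [hW, hφ]; exact h.inj
  · rw [hW, hφ]; exact h.cont
  · rw [hW, hφ]; exact h.openMap
  · intro τ hτ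
    rw [hW, hφ]
    rcases X.simplex_cases hτ with ⟨σ, hσ, rfl⟩ | ⟨ρ, hρ, rfl⟩
    · obtain ⟨B, hBimg, hfB⟩ := X.old_simplex hσ
      obtain ⟨s, hs, hσs⟩ := S.exists_top_of_mem_P hσ.1.1
      obtain ⟨A, hA⟩ := h.affine s hs.1
      refine ⟨A.comp B, fun y hy => ?_⟩
      have hBy : B y ∈ convexHull ℝ (σ : Set (Fin st.N → ℝ)) := by rw [← hBimg]; exact ⟨y, hy.1, rfl⟩
      have hfy : X.f₃c y = S.fbend (B y) := hfB y hy.1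
      have hW' : X.f₃c y ∈ st.W j := hy.2
      -- the point `B y` is not moved
      have hunm : S.fbend (B y) = st.f (B y) := by
        by_contra hne
        exact hdisj _ (by rw [← hfy]; exact hW') (fbend_mem_of_ne st P k hinv S hne)
      show st.φ j (X.f₃c y) = A (B y)
      rw [hfy, hunm]
      exact hA ⟨hσs hBy, by show st.f (B y) ∈ st.W j; rw [← hunm, ← hfy]; exact hW'⟩
    · refine ⟨0, fun y hy => ?_⟩
      exact (hdisj _ hy.2 (new_image_subset st P k hinv S X rfl rfl hρ ⟨y, hy.1, rfl⟩)).elim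
  · rw [hC]; exact h.compact
  · rw [hC, hW]; exact h.core

/-! ### Transported old charts -/

/-- Points of `Ψ '' (W ∩ V)`. [folklore] -/
theorem mem_image_W_iff (S : (bendInput st P k hinv).BendSetup) {j : ℕ} {q : M} :
    q ∈ S.Ψ '' (st.W j ∩ S.V) ↔ q ∈ S.Ψ '' S.V ∧ S.Ψinv q ∈ st.W j := by
  constructor
  · rintro ⟨p, ⟨hpW, hpV⟩, rfl⟩
    exact ⟨⟨p, hpV, rfl⟩, by rw [S.Ψinv_Ψ hpV]; exact hpW⟩
  · rintro ⟨⟨p, hpV, rfl⟩, hW⟩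
    rw [S.Ψinv_Ψ hpV] at hW
    exact ⟨p, ⟨hW, hpV⟩, rfl⟩

/-- `Ψ '' (W ∩ V)` is open. [folklore] -/
theorem isOpen_image_W (S : (bendInput st P k hinv).BendSetup) {j : ℕ} (h : ChartInv st j) : IsOpen (S.Ψ '' (st.W j ∩ S.V)) := by
  have : S.Ψ '' (st.W j ∩ S.V) = S.Ψ '' S.V ∩ S.Ψinv ⁻¹' st.W j := by
    ext q; rw [mem_image_W_iff]; rfl
  rw [this]
  exact S.continuousOn_Ψinv.isOpen_inter_preimage S.isOpen_image_V h.isOpen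

/-- A point of the trimmed complex whose bent image lies in `Ψ '' (W ∩ V)`: its original image
lies in `W ∩ V` and is recovered by `Ψinv`. [folklore] -/
theorem f_mem_of_fbend_mem (S : (bendInput st P k hinv).BendSetup) {j : ℕ} {x : Fin st.N → ℝ} (hx : x ∈ S.Kb.space)
    (hmem : S.fbend x ∈ S.Ψ '' (st.W j ∩ S.V)) : st.f x ∈ st.W j ∩ S.V ∧ S.Ψinv (S.fbend x) = st.f x := by
  obtain ⟨p, ⟨hpW, hpV⟩, hpx⟩ := hmem
  obtain ⟨x', hx', rfl⟩ := S.V_subset hpV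
  have hΨ : S.Ψ ((bendInput st P k hinv).f x') = S.fbend x' := S.Ψ_f (S.Kb_space_subset hx')
  rw [hΨ] at hpx
  have hxx : x' = x := S.injOn_fbend hx' hx hpx
  subst hxx
  exact ⟨⟨hpW, hpV⟩, by rw [← hΨ, S.Ψinv_Ψ hpV]; rfl⟩

/-- **Cores of old charts lie in `Ψ '' (W ∩ V)`**: the original image of the point representing a
core point lies in `W` (chart margin `eps`) and in `V` (protected margin and kept simplices).
[folklore] -/
theorem core_mem_image_W {j : ℕ} (hj : j < k) {p : M} (hp : p ∈ st.C' j) :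
    p ∈ (setup st P k hinv).Ψ '' (st.W j ∩ (setup st P k hinv).V) := by
  set S := setup st P k hinv with hS
  have h := hinv j hj
  have hpProt : p ∈ (bendInput st P k hinv).Prot := (mem_prot st k).2 ⟨j, hj, hp⟩
  obtain ⟨U, -, hpU, hUsub⟩ := S.exists_open_subset_image hpProt
  obtain ⟨y, hyK, hyp⟩ := hUsub hpU
  have hΨ : S.Ψ (st.f y) = S.fbend y := S.Ψ_f (S.Kb_space_subset hyK)
  suffices hq : st.f y ∈ st.W j ∩ S.V by exact ⟨st.f y, hq, by rw [hΨ, hyp]⟩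
  rcases fbend_eq_or st P k hinv S y with hunm | ⟨hyD, hsrc, heq, h7, h6⟩
  · have : st.f y = p := by rw [← hunm, hyp]
    rw [this]
    exact ⟨h.core hp, S.prot_subset_V hpProt⟩
  · rw [hyp] at hsrc heq
    have heq' : P.e p = S.Bmap y := heq
    have hδ : dist ((bendInput st P k hinv).F y) (P.e p) ≤ S.δ₀ := by
      rw [heq', dist_comm, dist_eq_norm]; exact S.norm_Bmap_sub_F_le hyD
    have hfy : st.f y = P.e.symm ((bendInput st P k hinv).F y) := (P.e.left_inv hyD.2).symm
    refine ⟨?_, ?_⟩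
    · -- chart margin
      have hsub := (eps_spec st P k hinv).2.2 j hj p hp hsrc (by rw [heq']; exact h7)
      rw [hfy]
      exact hsub ⟨_, mem_closedBall.2 (hδ.trans S.δ₀_le_εreq), rfl⟩
    · -- protected margin and kept simplices: a chart ball about `F y` inside `f '' K''.space`
      have hballY : closedBall (P.e p) S.ρP ⊆ (bendInput st P k hinv).Y :=
        S.hρPb p hpProt hsrc (by show P.e p ∈ P.B 7; rw [heq']; exact h7)
      have hp2 : P.e p ∈ cthickening ((bendInput st P k hinv).η / 2) (bendInput st P k hinv).R₃ := by
        rw [heq']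
        refine mem_cthickening_of_dist_le _ ((bendInput st P k hinv).F y) _ _ h6 ?_
        rw [dist_eq_norm]
        linarith [S.norm_Bmap_sub_F_le hyD, S.δ₀_le_eta, (bendInput st P k hinv).hη]
      have hsubK : P.e.symm '' ball ((bendInput st P k hinv).F y) (S.ρ₀ / 2) ⊆ st.f '' S.Kb.space := by
        rintro _ ⟨z, hz, rfl⟩
        have hzY : z ∈ (bendInput st P k hinv).Y := hballY (mem_closedBall.2 (by
          calc dist z (P.e p) ≤ dist z ((bendInput st P k hinv).F y) + dist ((bendInput st P k hinv).F y) (P.e p) :=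
                dist_triangle _ _ _
            _ ≤ S.ρ₀ / 2 + S.δ₀ := add_le_add (mem_ball.1 hz).le hδ
            _ ≤ S.ρP := by linarith [S.δ₀_le_ρ₀, S.ρ₀_le_ρP, S.ρ₀_pos]))
        obtain ⟨y', hy'D, rfl⟩ := hzY
        obtain ⟨t, ht, hy't⟩ := S.exists_PTop_of_mem_space hy'D.1
        have hdist : dist ((bendInput st P k hinv).F y') (P.e p) ≤ S.ρ₀ := by
          calc dist ((bendInput st P k hinv).F y') (P.e p)
              ≤ dist ((bendInput st P k hinv).F y') ((bendInput st P k hinv).F y) + dist ((bendInput st P k hinv).F y) (P.e p) :=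
                dist_triangle _ _ _
            _ ≤ S.ρ₀ / 2 + S.δ₀ := add_le_add (mem_ball.1 hz).le hδ
            _ ≤ S.ρ₀ := by linarith [S.δ₀_le_ρ₀, S.ρ₀_pos]
        have hkept := S.kept_of_near_prot hpProt hsrc hp2 ht hy't hy'D hdist
        exact ⟨y', S.Kb.convexHull_subset_space (S.mem_Kb_of_keptTop hkept) hy't, (P.e.left_inv hy'D.2).symm⟩
      have hopen : IsOpen (P.e.symm '' ball ((bendInput st P k hinv).F y) (S.ρ₀ / 2)) :=
        P.e.symm.isOpen_image_of_subset_source isOpen_ball (by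
          rw [P.e.symm_source]
          intro z hz
          refine (bendInput st P k hinv).Y_subset_target (hballY (mem_closedBall.2 ?_))
          calc dist z (P.e p) ≤ dist z ((bendInput st P k hinv).F y) + dist ((bendInput st P k hinv).F y) (P.e p) :=
                dist_triangle _ _ _
            _ ≤ S.ρ₀ / 2 + S.δ₀ := add_le_add (mem_ball.1 hz).le hδ
            _ ≤ S.ρP := by linarith [S.δ₀_le_ρ₀, S.ρ₀_le_ρP, S.ρ₀_pos])
      show st.f y ∈ interior (st.f '' S.Kb.space)
      rw [mem_interior]
      exact ⟨_, hsubK, hopen, by rw [hfy]; exact ⟨_, mem_ball_self (half_pos S.ρ₀_pos), rfl⟩⟩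

/-- **A transported old chart satisfies the invariants.** [folklore] -/
theorem chartInv_next_touched {j : ℕ} (hj : j < k) (hu : ¬Untouched st P j) : ChartInv (next st P k hinv) j := by
  have h := hinv j hj
  obtain ⟨hW, hφ, hC, hD⟩ := next_touched st P k hinv hj hu
  set S := setup st P k hinv with hS
  set X := extInput st P k hinv with hX
  have himgo := isOpen_image_W st P k hinv S h
  have hR₀c : IsClosed (P.e.symm '' P.B 1) :=
    ((P.isCompact_B 1).image_of_continuousOn (P.e.continuousOn_symm.mono (P.B_subset_target 1))).isClosed
  -- the new open set
  have hW' : (next st P k hinv).W j = (S.Ψ '' (st.W j ∩ S.V) \ P.e.symm '' P.B 1) ∩ st.D j := hW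
  have hsubimg : (next st P k hinv).W j ⊆ S.Ψ '' (st.W j ∩ S.V) := by rw [hW']; exact fun q hq => hq.1.1
  refine ⟨?_, ?_, ?_, ?_, ?_, ?_, ?_, ?_, ?_, ?_⟩
  · rw [hW']; exact (himgo.sdiff hR₀c).inter h.isOpenD
  · rw [hD]; exact h.isOpenD
  · rw [hW', hD]; exact inter_subset_right
  · intro q hq
    obtain ⟨p, ⟨-, hpV⟩, rfl⟩ := hsubimg hq
    obtain ⟨x, hx, rfl⟩ := S.V_subset hpV
    show S.Ψ ((bendInput st P k hinv).f x) ∈ X.f₃c '' X.K₃c.space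
    rw [X.f₃c_image, S.Ψ_f (S.Kb_space_subset hx)]
    exact Or.inl ⟨x, hx, rfl⟩
  · rw [hφ]
    intro q hq q' hq' hqq
    obtain ⟨hq1, hq2⟩ := (mem_image_W_iff st P k hinv S).1 (hsubimg hq)
    obtain ⟨hq1', hq2'⟩ := (mem_image_W_iff st P k hinv S).1 (hsubimg hq')
    have heq : S.Ψinv q = S.Ψinv q' := h.inj hq2 hq2' hqq
    rw [← (S.Ψ_Ψinv hq1).1, ← (S.Ψ_Ψinv hq1').1, heq]
  · rw [hφ]
    refine h.cont.comp (S.continuousOn_Ψinv.mono fun q hq => ((mem_image_W_iff st P k hinv S).1 (hsubimg hq)).1) ?_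
    exact fun q hq => ((mem_image_W_iff st P k hinv S).1 (hsubimg hq)).2
  · intro U hU hUo
    rw [hφ, Set.image_comp]
    have hUsub : U ⊆ S.Ψ '' S.V := fun q hq => ((mem_image_W_iff st P k hinv S).1 (hsubimg (hU hq))).1
    have hpre : S.Ψinv '' U = S.V ∩ S.Ψ ⁻¹' U := by
      ext p
      constructor
      · rintro ⟨q, hq, rfl⟩
        obtain ⟨hΨ, hV⟩ := S.Ψ_Ψinv (hUsub hq)
        exact ⟨hV, by rw [mem_preimage, hΨ]; exact hq⟩
      · rintro ⟨hpV, hpU⟩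
        exact ⟨S.Ψ p, hpU, S.Ψinv_Ψ hpV⟩
    rw [hpre]
    refine h.openMap _ (fun p hp => ?_) (S.continuousOn_Ψ.isOpen_inter_preimage S.isOpen_V hUo)
    have := ((mem_image_W_iff st P k hinv S).1 (hsubimg (hU hp.2))).2
    rwa [S.Ψinv_Ψ hp.1] at this
  · intro τ hτ
    rw [hφ]
    rcases X.simplex_cases hτ with ⟨σ, hσ, rfl⟩ | ⟨ρ, hρ, rfl⟩
    · obtain ⟨B, hBimg, hfB⟩ := X.old_simplex hσ
      obtain ⟨s, hs, hσs⟩ := S.exists_top_of_mem_P hσ.1.1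
      obtain ⟨A, hA⟩ := h.affine s hs.1
      refine ⟨A.comp B, fun y hy => ?_⟩
      have hBy : B y ∈ convexHull ℝ (σ : Set (Fin st.N → ℝ)) := by rw [← hBimg]; exact ⟨y, hy.1, rfl⟩
      have hfy : X.f₃c y = S.fbend (B y) := hfB y hy.1
      obtain ⟨⟨hfW, -⟩, hinv'⟩ := f_mem_of_fbend_mem st P k hinv S (S.Kb.convexHull_subset_space hσ.1 hBy)
        (by rw [← hfy]; exact hsubimg hy.2)
      show st.φ j (S.Ψinv (X.f₃c y)) = A (B y)
      rw [hfy, hinv']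
      exact hA ⟨hσs hBy, hfW⟩
    · obtain ⟨A, hA, hAimg, hinside⟩ := X.new_simplex hρ
      rcases hinside with hbox | ⟨u₀, hu₀, hsub⟩
      · -- the simplex maps into `e.symm '' R₀`, off the new open set
        refine ⟨0, fun y hy => ?_⟩
        exfalso
        have hy2 : X.f₃c y ∈ (next st P k hinv).W j := hy.2
        rw [hW'] at hy2
        obtain ⟨hsrc, heq⟩ := hA y hy.1
        apply hy2.1.2
        refine ⟨A y, ?_, by
          have heq' : P.e (X.f₃c y) = A y := heq
          rw [← heq', P.e.left_inv hsrc]⟩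
        have hAy : A y ∈ X.R₀ := hbox (by rw [← hAimg]; exact ⟨y, hy.1, rfl⟩)
        exact hAy
      · -- the simplex maps into the image of the straight simplex `u₀`: pull back affinely
        have hinjΛ : InjOn (S.A u₀ hu₀.1.1) (convexHull ℝ (u₀ : Set (Fin st.N → ℝ))) := fun x hx x' hx' hxx => by
          rw [← S.Λ_eqOn hu₀.1.1 hx, ← S.Λ_eqOn hu₀.1.1 hx'] at hxx
          exact S.injOn_Λ_str (S.StrCx.convexHull_subset_space hu₀ hx) (S.StrCx.convexHull_subset_space hu₀ hx') hxx
        obtain ⟨L, hL⟩ := exists_affine_leftInv (S.A u₀ hu₀.1.1) hinjΛ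
        obtain ⟨s, hs, hu₀s⟩ := S.exists_top_of_mem_P hu₀.1.1
        obtain ⟨As, hAs⟩ := h.affine s hs.1
        refine ⟨As.comp (L.comp A), fun y hy => ?_⟩
        have hAy : A y ∈ convexHull ℝ (ρ : Set (𝔼 n)) := by rw [← hAimg]; exact ⟨y, hy.1, rfl⟩
        obtain ⟨x₀, hx₀, hx₀y⟩ := hsub hAy
        have hLx : L (A y) = x₀ := by rw [← hx₀y, S.Λ_eqOn hu₀.1.1 hx₀]; exact hL x₀ hx₀
        obtain ⟨hxs, hxe, hxΛ⟩ := S.straight hu₀.1.1 hu₀.2 hx₀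
        obtain ⟨hsrc, heq⟩ := hA y hy.1
        have hfy : X.f₃c y = S.fbend x₀ := by
          have h1 : (bendInput st P k hinv).e (X.f₃c y) = (bendInput st P k hinv).e (S.fbend x₀) := by
            rw [heq, hxe, ← hxΛ, hx₀y]
          exact (bendInput st P k hinv).e.injOn hsrc hxs h1
        obtain ⟨⟨hfW, -⟩, hinv'⟩ := f_mem_of_fbend_mem st P k hinv S (S.Kb.convexHull_subset_space hu₀.1 hx₀)
          (by rw [← hfy]; exact hsubimg hy.2)
        show st.φ j (S.Ψinv (X.f₃c y)) = As (L (A y))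
        rw [hfy, hinv', hLx]
        exact hAs ⟨hu₀s hx₀, hfW⟩
  · rw [hC]
    exact h.compact.diff (P.e.symm.isOpen_image_of_subset_source (isOpen_openBox _ _)
      (by rw [P.e.symm_source]; exact (openBox_subset_box _ _).trans (P.B_subset_target 2)))
  · rw [hC, hW']
    rintro p ⟨hp, hp2⟩
    refine ⟨⟨core_mem_image_W st P k hinv hj hp, fun hp1 => hp2 ?_⟩, h.subsetD (h.core hp)⟩
    obtain ⟨z, hz, rfl⟩ := hp1
    exact ⟨z, P.B_subset_openBox 1 hz, rfl⟩

/-! ### Assembly -/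

/-- **All chart invariants hold for the new state.** [folklore] -/
theorem chartInv_next (hunborn : ∀ j, k < j → st.W j = ∅ ∧ st.C' j = ∅ ∧ st.D j = ∅) (j : ℕ) :
    ChartInv (next st P k hinv) j := by
  rcases lt_trichotomy j k with hj | rfl | hj
  · by_cases hu : Untouched st P j
    · exact chartInv_next_untouched st P k hinv hj hu
    · exact chartInv_next_touched st P k hinv hj hu
  · exact chartInv_next_new st P j hinv
  · have := hunborn j hj
    exact chartInv_empty _ j (next_W_gt st P k hinv hj) (next_C'_gt st P k hinv hj) (next_D_gt st P k hinv hj)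

/-- Unborn charts stay empty. [folklore] -/
theorem next_unborn (j : ℕ) (hj : k + 1 ≤ j) :
    (next st P k hinv).W j = ∅ ∧ (next st P k hinv).C' j = ∅ ∧ (next st P k hinv).D j = ∅ :=
  ⟨next_W_gt st P k hinv hj, next_C'_gt st P k hinv hj, next_D_gt st P k hinv hj⟩

/-- **Coverage**: the cores of the new state cover the old cores and the new cover piece.
[folklore] -/
theorem cores_next (hunborn : ∀ j, k ≤ j → st.C' j = ∅) :
    (⋃ j, st.C' j) ∪ P.Cpiece ⊆ ⋃ j, (next st P k hinv).C' j := by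
  have hCk := next_C'_new st P k hinv
  -- a point of `e.symm '' B₂` which is an old core point or a point of the piece is in the new core
  have hnew : ∀ p ∈ P.e.symm '' P.B 2, p ∈ prot st k ∪ P.Cpiece → p ∈ ⋃ j, (next st P k hinv).C' j :=
    fun p hp2 hp => mem_iUnion.2 ⟨k, by rw [hCk]; exact ⟨hp2, hp⟩⟩
  rintro p (hp | hp)
  · obtain ⟨j, hpj⟩ := mem_iUnion.1 hp
    have hj : j < k := by
      by_contra h
      rw [hunborn j (not_lt.1 h)] at hpj
      exact hpj
    by_cases hp2 : p ∈ P.e.symm '' openBox (P.a 2) (P.b 2)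
    · refine hnew p ?_ (Or.inl ((mem_prot st k).2 ⟨j, hj, hpj⟩))
      obtain ⟨z, hz, rfl⟩ := hp2
      exact ⟨z, openBox_subset_box _ _ hz, rfl⟩
    · refine mem_iUnion.2 ⟨j, ?_⟩
      by_cases hu : Untouched st P j
      · rw [(next_untouched st P k hinv hj hu).2.2.1]; exact hpj
      · rw [(next_touched st P k hinv hj hu).2.2.1]; exact ⟨hpj, hp2⟩
  · refine hnew p ?_ (Or.inr hp)
    obtain ⟨z, hz, rfl⟩ := hp
    exact ⟨z, P.B_mono (by decide) hz, rfl⟩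

/-- The birth regions: unchanged below `k`, the new one inside `e.symm '' B₇`. [folklore] -/
theorem next_D_le {j : ℕ} (hj : j < k) : (next st P k hinv).D j = st.D j := by
  by_cases hu : Untouched st P j
  · exact (next_untouched st P k hinv hj hu).2.2.2
  · exact (next_touched st P k hinv hj hu).2.2.2

/-- Auxiliary (`next_D_new_subset`). [folklore] -/
theorem next_D_new_subset : (next st P k hinv).D k ⊆ P.e.symm '' P.B 7 := by
  rw [next_D_new]
  rintro _ ⟨z, hz, rfl⟩
  exact ⟨z, P.B_mono (by decide) (openBox_subset_box _ _ hz), rfl⟩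

/-- **The image of the new state contains the old chart domains' cores and the new piece**:
every old core and the piece lie in `f '' K.space` of the new state. [folklore] -/
theorem cores_subset_image_next (hunb' : ∀ j, k < j → st.W j = ∅ ∧ st.C' j = ∅ ∧ st.D j = ∅) :
    (⋃ j, (next st P k hinv).C' j) ⊆ (next st P k hinv).f '' (next st P k hinv).K.space := fun p hp => by
  obtain ⟨j, hpj⟩ := mem_iUnion.1 hp
  have h := chartInv_next st P k hinv hunb' j
  exact h.subset (h.core hpj)

end Inv

end Literature.Topology.FourManifolds
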